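import Mathlib
import Summits.Ventures.PercRepro2.PointSplitBHK

/-!
# (3M) IS the point-split polarised BHK slack — the reduction `(PS) ⟹ ThreeMark`
(blind cell PercRepro2, night-3 g23, 2026-08-28; `proofs/NIGHT3-CERT.md` §32)

The eight cells `m(χ, ω, β) = P(Q, [v ∈ C(a₂)] = χ, [o ∈ C(a₂)] = ω, [b ∈ C(a₁)] = β)` of
g21's `RootEdgeCells.lean` read the weighted expectations of `PointSplitBHK.lean` at `s = a₂`,
`X = Y = {a₁}`, `F = 1 − g` (`g` = `delClusterProb` of `{U | b ∈ U}` at `a₁`: the probability that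
`b ∈ C(a₁)` after deleting the cluster of `a₂`, so `E[F·1_Q] = P(Q, b ∉ C(a₁))`), `G = 1_{o ∈ ·}`,
and the point weights `1_{v ∈ C(a₂)}`, `1_{v ∉ C(a₂)}`:

  `E[FG·1_{vH}·1_Q] = m(110)`, `E[1_{v̄H}·1_Q] = m(000) + m(001) + m(010) + m(011)`,
  `E[FG·1_{v̄H}·1_Q] = m(010)`, `E[1_{vH}·1_Q] = m(100) + m(101) + m(110) + m(111)`,
  `E[F·1_{vH}·1_Q] = m(100) + m(110)`, `E[G·1_{v̄H}·1_Q] = m(010) + m(011)`,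
  `E[F·1_{v̄H}·1_Q] = m(000) + m(010)`, `E[G·1_{vH}·1_Q] = m(110) + m(111)`,

and the polarised form collapses to the (3M)-slack
`m(101)m(010) + m(001)m(110) − m(011)m(100) − m(111)m(000)` (`threeMark_slack_eq_mixedForm`).
Hence **`threeMark_of_pointSplitBHK`**: the point-split BHK candidate (PS) at the source `a₂`
implies (3M) for every marking `(a₁, b, o, v)` — and with g22's `rootCross_of_threeMark` the
candidate of record RootCross and the `a₃`-inactive root-edge rows.  Own work; standard axioms.
-/

namespace Summit.Ventures.PercRepro2

open UnionCluster

namespace CovForm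

namespace PointSplit

open RootEdge

variable {V : Type*} {E : Type*} [Fintype E] [DecidableEq E]
  {R : Type*} [Field R] [LinearOrder R] [IsStrictOrderedRing R]

/-! ## Indicators of cluster events as cluster functionals -/

omit [Fintype E] [DecidableEq E] [LinearOrder R] [IsStrictOrderedRing R] in
/-- `1_{C_x ∈ 𝓔}(ω) = 1_𝓔(C_x(ω))`. -/
lemma indicator_clusterInEvent_apply (ends : E → Sym2 V) (x : V) (𝓔 : Set (Set V))
    (ω : Config E) :
    (clusterInEvent ends x 𝓔).indicator (1 : Config E → R) ω =
      𝓔.indicator (1 : Set V → R) (cluster ends ω x) := by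
  by_cases h : cluster ends ω x ∈ 𝓔
  · rw [Set.indicator_of_mem (show ω ∈ clusterInEvent ends x 𝓔 from h), Set.indicator_of_mem h]
    rfl
  · rw [Set.indicator_of_notMem (show ω ∉ clusterInEvent ends x 𝓔 from h),
      Set.indicator_of_notMem h]

omit [Fintype E] [DecidableEq E] [LinearOrder R] [IsStrictOrderedRing R] in
/-- `{C_x ∈ 𝓔}ᶜ = {C_x ∈ 𝓔ᶜ}`. -/
lemma compl_clusterInEvent (ends : E → Sym2 V) (x : V) (𝓔 : Set (Set V)) :
    (clusterInEvent ends x 𝓔)ᶜ = clusterInEvent ends x 𝓔ᶜ := by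
  ext ω
  simp only [Set.mem_compl_iff, mem_clusterInEvent]

omit [LinearOrder R] [IsStrictOrderedRing R] in
/-- `E[1 · 1_{C_s ∈ 𝓦} · 1_{s↮X}] = P(C_s ∈ 𝓦, s ↮ X)`. -/
lemma wExpect_one_indicator (p : E → R) (ends : E → Sym2 V) (s : V) (X : Finset V)
    (𝓦 : Set (Set V)) :
    wExpect p ends s X (fun _ => (1 : R)) ((clusterInEvent ends s 𝓦).indicator 1) =
      prob p (clusterInEvent ends s 𝓦 ∩ avoidAll ends s X) := by
  unfold wExpect
  rw [prob_clusterInEvent_inter_eq_expect]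
  refine congrArg _ (funext fun ω => ?_)
  rw [indicator_clusterInEvent_apply, one_mul]

omit [LinearOrder R] [IsStrictOrderedRing R] in
/-- `E[1_𝓤(C_s) · 1_{C_s ∈ 𝓦} · 1_{s↮X}] = P(C_s ∈ 𝓤 ∩ 𝓦, s ↮ X)`. -/
lemma wExpect_indicator_indicator (p : E → R) (ends : E → Sym2 V) (s : V) (X : Finset V)
    (𝓤 𝓦 : Set (Set V)) :
    wExpect p ends s X (𝓤.indicator 1) ((clusterInEvent ends s 𝓦).indicator 1) =
      prob p (clusterInEvent ends s (𝓤 ∩ 𝓦) ∩ avoidAll ends s X) := by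
  unfold wExpect
  rw [prob_clusterInEvent_inter_eq_expect]
  refine congrArg _ (funext fun ω => ?_)
  rw [indicator_clusterInEvent_apply, Set.inter_indicator_one, Pi.mul_apply]

omit [LinearOrder R] [IsStrictOrderedRing R] in
/-- `E[(1 − g)(C_s) · 1_{C_s ∈ 𝓦} · 1_{s↮X}] = P(C_s ∈ 𝓦, s↮X) − P(C_s ∈ 𝓦, C_t ∈ 𝓥, s↮X)` for
`t ∈ X`, `g = delClusterProb` of `𝓥` at `t`. -/
lemma wExpect_one_sub_del [Fintype V] [DecidableEq V] (p : E → R) (ends : E → Sym2 V) (s t : V)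
    {X : Finset V} (ht : t ∈ X) (𝓥 𝓦 : Set (Set V)) :
    wExpect p ends s X (fun W => 1 - delClusterProb p ends t 𝓥 W)
        ((clusterInEvent ends s 𝓦).indicator 1) =
      prob p (clusterInEvent ends s 𝓦 ∩ avoidAll ends s X) -
        prob p (clusterInEvent ends s 𝓦 ∩ clusterInEvent ends t 𝓥 ∩ avoidAll ends s X) := by
  unfold wExpect
  rw [prob_clusterInEvent_inter_eq_expect, prob_clusterIn_inter_avoid_eq_expect p ends s t ht,
    ← expect_sub]
  refine congrArg _ (funext fun ω => ?_)
  rw [indicator_clusterInEvent_apply]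
  simp only [Pi.sub_apply]
  ring

omit [LinearOrder R] [IsStrictOrderedRing R] in
/-- `E[(1 − g)(C_s) · 1_𝓤(C_s) · 1_{C_s ∈ 𝓦} · 1_{s↮X}] = P(C_s ∈ 𝓤 ∩ 𝓦, s↮X) −
P(C_s ∈ 𝓤 ∩ 𝓦, C_t ∈ 𝓥, s↮X)` for `t ∈ X`. -/
lemma wExpect_one_sub_del_indicator [Fintype V] [DecidableEq V] (p : E → R) (ends : E → Sym2 V)
    (s t : V) {X : Finset V} (ht : t ∈ X) (𝓤 𝓥 𝓦 : Set (Set V)) :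
    wExpect p ends s X (fun W => (1 - delClusterProb p ends t 𝓥 W) * 𝓤.indicator 1 W)
        ((clusterInEvent ends s 𝓦).indicator 1) =
      prob p (clusterInEvent ends s (𝓤 ∩ 𝓦) ∩ avoidAll ends s X) -
        prob p (clusterInEvent ends s (𝓤 ∩ 𝓦) ∩ clusterInEvent ends t 𝓥 ∩ avoidAll ends s X) := by
  unfold wExpect
  rw [prob_clusterInEvent_inter_eq_expect, prob_clusterIn_inter_avoid_eq_expect p ends s t ht,
    ← expect_sub]
  refine congrArg _ (funext fun ω => ?_)
  simp only [indicator_clusterInEvent_apply, Set.inter_indicator_one, Pi.mul_apply, Pi.sub_apply]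
  ring

/-! ## The masses in the cells -/

section Masses

variable [DecidableEq V] (p : E → R) (ends : E → Sym2 V) (a₁ a₂ b o v : V)

omit [DecidableEq V] [LinearOrder R] [IsStrictOrderedRing R] in
/-- `P(Q, v ∈ C₂)`. -/
lemma massPS_v : prob p (clusterInEvent ends a₂ {W | v ∈ W} ∩ avoidAll ends a₂ {a₁}) =
    cell p ends a₁ a₂ b o v true true true + cell p ends a₁ a₂ b o v true true false +
      cell p ends a₁ a₂ b o v true false true + cell p ends a₁ a₂ b o v true false false := by
  rw [prob_eq_sum_cells p ends a₁ a₂ b o v]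
  have e : ∀ χ ω β : Bool, (clusterInEvent ends a₂ {W | v ∈ W} ∩ avoidAll ends a₂ {a₁}) ∩
      cellSet ends a₁ a₂ b o v χ ω β =
      if χ = true then avoidAll ends a₂ {a₁} ∩ cellSet ends a₁ a₂ b o v χ ω β else ∅ := by
    intro χ ω β
    cases χ <;> cases ω <;> cases β <;>
      · ext ω'
        simp only [Set.mem_inter_iff, Set.mem_empty_iff_false, cellSet, Set.mem_setOf_eq,
          mem_clusterInEvent, mem_cluster, Bool.false_eq_true, iff_false,
          iff_true, if_true, if_false]
        tauto
  simp only [e, Bool.false_eq_true, if_true, if_false, prob_empty, cell]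
  ring

omit [DecidableEq V] [LinearOrder R] [IsStrictOrderedRing R] in
/-- `P(Q, v ∉ C₂)`. -/
lemma massPS_nv : prob p (clusterInEvent ends a₂ {W | v ∈ W}ᶜ ∩ avoidAll ends a₂ {a₁}) =
    cell p ends a₁ a₂ b o v false true true + cell p ends a₁ a₂ b o v false true false +
      cell p ends a₁ a₂ b o v false false true + cell p ends a₁ a₂ b o v false false false := by
  rw [prob_eq_sum_cells p ends a₁ a₂ b o v]
  have e : ∀ χ ω β : Bool, (clusterInEvent ends a₂ {W | v ∈ W}ᶜ ∩ avoidAll ends a₂ {a₁}) ∩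
      cellSet ends a₁ a₂ b o v χ ω β =
      if χ = false then avoidAll ends a₂ {a₁} ∩ cellSet ends a₁ a₂ b o v χ ω β else ∅ := by
    intro χ ω β
    cases χ <;> cases ω <;> cases β <;>
      · ext ω'
        simp only [Set.mem_inter_iff, Set.mem_empty_iff_false, cellSet, Set.mem_setOf_eq,
          mem_clusterInEvent, Set.mem_compl_iff, mem_cluster, Bool.false_eq_true,
          Bool.true_eq_false, iff_false, iff_true, if_true, if_false]
        tauto
  simp only [e, Bool.true_eq_false, if_true, if_false, prob_empty, cell]
  ring

omit [DecidableEq V] [LinearOrder R] [IsStrictOrderedRing R] in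
/-- `P(Q, v ∈ C₂, b ∈ C₁)`. -/
lemma massPS_v_b : prob p (clusterInEvent ends a₂ {W | v ∈ W} ∩
      clusterInEvent ends a₁ {U | b ∈ U} ∩ avoidAll ends a₂ {a₁}) =
    cell p ends a₁ a₂ b o v true true true + cell p ends a₁ a₂ b o v true false true := by
  rw [prob_eq_sum_cells p ends a₁ a₂ b o v]
  have e : ∀ χ ω β : Bool, (clusterInEvent ends a₂ {W | v ∈ W} ∩
      clusterInEvent ends a₁ {U | b ∈ U} ∩ avoidAll ends a₂ {a₁}) ∩
      cellSet ends a₁ a₂ b o v χ ω β =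
      if χ = true ∧ β = true then avoidAll ends a₂ {a₁} ∩ cellSet ends a₁ a₂ b o v χ ω β
      else ∅ := by
    intro χ ω β
    cases χ <;> cases ω <;> cases β <;>
      · ext ω'
        simp only [Set.mem_inter_iff, Set.mem_empty_iff_false, cellSet, Set.mem_setOf_eq,
          mem_clusterInEvent, mem_cluster, Bool.false_eq_true, iff_false,
          iff_true, if_true, if_false, and_self, and_true, and_false]
        tauto
  simp only [e, Bool.false_eq_true, and_self, and_true, and_false, if_true,
    if_false, prob_empty, cell]
  ring

omit [DecidableEq V] [LinearOrder R] [IsStrictOrderedRing R] in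
/-- `P(Q, v ∉ C₂, b ∈ C₁)`. -/
lemma massPS_nv_b : prob p (clusterInEvent ends a₂ {W | v ∈ W}ᶜ ∩
      clusterInEvent ends a₁ {U | b ∈ U} ∩ avoidAll ends a₂ {a₁}) =
    cell p ends a₁ a₂ b o v false true true + cell p ends a₁ a₂ b o v false false true := by
  rw [prob_eq_sum_cells p ends a₁ a₂ b o v]
  have e : ∀ χ ω β : Bool, (clusterInEvent ends a₂ {W | v ∈ W}ᶜ ∩
      clusterInEvent ends a₁ {U | b ∈ U} ∩ avoidAll ends a₂ {a₁}) ∩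
      cellSet ends a₁ a₂ b o v χ ω β =
      if χ = false ∧ β = true then avoidAll ends a₂ {a₁} ∩ cellSet ends a₁ a₂ b o v χ ω β
      else ∅ := by
    intro χ ω β
    cases χ <;> cases ω <;> cases β <;>
      · ext ω'
        simp only [Set.mem_inter_iff, Set.mem_empty_iff_false, cellSet, Set.mem_setOf_eq,
          mem_clusterInEvent, Set.mem_compl_iff, mem_cluster, Bool.false_eq_true,
          Bool.true_eq_false, iff_false, iff_true, if_true, if_false, and_self, and_true,
          and_false]
        tauto
  simp only [e, Bool.false_eq_true, Bool.true_eq_false, and_self, and_true, and_false, if_true,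
    if_false, prob_empty, cell]
  ring

omit [DecidableEq V] [LinearOrder R] [IsStrictOrderedRing R] in
/-- `P(Q, o ∈ C₂, v ∈ C₂)`. -/
lemma massPS_ov : prob p (clusterInEvent ends a₂ ({W | o ∈ W} ∩ {W | v ∈ W}) ∩
      avoidAll ends a₂ {a₁}) =
    cell p ends a₁ a₂ b o v true true true + cell p ends a₁ a₂ b o v true true false := by
  rw [prob_eq_sum_cells p ends a₁ a₂ b o v]
  have e : ∀ χ ω β : Bool, (clusterInEvent ends a₂ ({W | o ∈ W} ∩ {W | v ∈ W}) ∩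
      avoidAll ends a₂ {a₁}) ∩ cellSet ends a₁ a₂ b o v χ ω β =
      if χ = true ∧ ω = true then avoidAll ends a₂ {a₁} ∩ cellSet ends a₁ a₂ b o v χ ω β
      else ∅ := by
    intro χ ω β
    cases χ <;> cases ω <;> cases β <;>
      · ext ω'
        simp only [Set.mem_inter_iff, Set.mem_empty_iff_false, cellSet, Set.mem_setOf_eq,
          mem_clusterInEvent, mem_cluster, Bool.false_eq_true, iff_false,
          iff_true, if_true, if_false, and_self, and_true, and_false]
        tauto
  simp only [e, Bool.false_eq_true, and_self, and_true, and_false, if_true,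
    if_false, prob_empty, cell]
  ring

omit [DecidableEq V] [LinearOrder R] [IsStrictOrderedRing R] in
/-- `P(Q, o ∈ C₂, v ∉ C₂)`. -/
lemma massPS_onv : prob p (clusterInEvent ends a₂ ({W | o ∈ W} ∩ {W | v ∈ W}ᶜ) ∩
      avoidAll ends a₂ {a₁}) =
    cell p ends a₁ a₂ b o v false true true + cell p ends a₁ a₂ b o v false true false := by
  rw [prob_eq_sum_cells p ends a₁ a₂ b o v]
  have e : ∀ χ ω β : Bool, (clusterInEvent ends a₂ ({W | o ∈ W} ∩ {W | v ∈ W}ᶜ) ∩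
      avoidAll ends a₂ {a₁}) ∩ cellSet ends a₁ a₂ b o v χ ω β =
      if χ = false ∧ ω = true then avoidAll ends a₂ {a₁} ∩ cellSet ends a₁ a₂ b o v χ ω β
      else ∅ := by
    intro χ ω β
    cases χ <;> cases ω <;> cases β <;>
      · ext ω'
        simp only [Set.mem_inter_iff, Set.mem_empty_iff_false, cellSet, Set.mem_setOf_eq,
          mem_clusterInEvent, Set.mem_compl_iff, mem_cluster, Bool.false_eq_true,
          Bool.true_eq_false, iff_false, iff_true, if_true, if_false, and_self, and_true,
          and_false]
        tauto
  simp only [e, Bool.false_eq_true, Bool.true_eq_false, and_self, and_true, and_false, if_true,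
    if_false, prob_empty, cell]
  ring

omit [DecidableEq V] [LinearOrder R] [IsStrictOrderedRing R] in
/-- `P(Q, o ∈ C₂, v ∈ C₂, b ∈ C₁)`. -/
lemma massPS_ov_b : prob p (clusterInEvent ends a₂ ({W | o ∈ W} ∩ {W | v ∈ W}) ∩
      clusterInEvent ends a₁ {U | b ∈ U} ∩ avoidAll ends a₂ {a₁}) =
    cell p ends a₁ a₂ b o v true true true := by
  rw [prob_eq_sum_cells p ends a₁ a₂ b o v]
  have e : ∀ χ ω β : Bool, (clusterInEvent ends a₂ ({W | o ∈ W} ∩ {W | v ∈ W}) ∩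
      clusterInEvent ends a₁ {U | b ∈ U} ∩ avoidAll ends a₂ {a₁}) ∩
      cellSet ends a₁ a₂ b o v χ ω β =
      if χ = true ∧ ω = true ∧ β = true then
        avoidAll ends a₂ {a₁} ∩ cellSet ends a₁ a₂ b o v χ ω β else ∅ := by
    intro χ ω β
    cases χ <;> cases ω <;> cases β <;>
      · ext ω'
        simp only [Set.mem_inter_iff, Set.mem_empty_iff_false, cellSet, Set.mem_setOf_eq,
          mem_clusterInEvent, mem_cluster, Bool.false_eq_true, iff_false,
          iff_true, if_true, if_false, and_self, and_true, and_false]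
        tauto
  simp only [e, Bool.false_eq_true, and_self, and_true, and_false, if_true,
    if_false, prob_empty, cell]
  ring

omit [DecidableEq V] [LinearOrder R] [IsStrictOrderedRing R] in
/-- `P(Q, o ∈ C₂, v ∉ C₂, b ∈ C₁)`. -/
lemma massPS_onv_b : prob p (clusterInEvent ends a₂ ({W | o ∈ W} ∩ {W | v ∈ W}ᶜ) ∩
      clusterInEvent ends a₁ {U | b ∈ U} ∩ avoidAll ends a₂ {a₁}) =
    cell p ends a₁ a₂ b o v false true true := by
  rw [prob_eq_sum_cells p ends a₁ a₂ b o v]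
  have e : ∀ χ ω β : Bool, (clusterInEvent ends a₂ ({W | o ∈ W} ∩ {W | v ∈ W}ᶜ) ∩
      clusterInEvent ends a₁ {U | b ∈ U} ∩ avoidAll ends a₂ {a₁}) ∩
      cellSet ends a₁ a₂ b o v χ ω β =
      if χ = false ∧ ω = true ∧ β = true then
        avoidAll ends a₂ {a₁} ∩ cellSet ends a₁ a₂ b o v χ ω β else ∅ := by
    intro χ ω β
    cases χ <;> cases ω <;> cases β <;>
      · ext ω'
        simp only [Set.mem_inter_iff, Set.mem_empty_iff_false, cellSet, Set.mem_setOf_eq,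
          mem_clusterInEvent, Set.mem_compl_iff, mem_cluster, Bool.false_eq_true,
          Bool.true_eq_false, iff_false, iff_true, if_true, if_false, and_self, and_true,
          and_false]
        tauto
  simp only [e, Bool.false_eq_true, Bool.true_eq_false, and_self, and_true, and_false, if_true,
    if_false, prob_empty, cell]
  ring

end Masses

/-! ## The (3M)-slack is the point-split polarised BHK slack -/

omit [LinearOrder R] [IsStrictOrderedRing R] in
/-- **(3M) = the polarised point-split BHK slack** at `s = a₂`, `X = Y = {a₁}`, `F = 1 − g`
(`g` the deleted-cluster probability of `b ∈ C(a₁)`), `G = 1_{o ∈ ·}`, split at `v`: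
`M(1_{v ∈ C₂}, 1_{v ∉ C₂}) = m(101)m(010) + m(001)m(110) − m(011)m(100) − m(111)m(000)`. -/
theorem threeMark_slack_eq_mixedForm [Fintype V] [DecidableEq V] (p : E → R) (ends : E → Sym2 V)
    (a₁ a₂ b o v : V) :
    mixedFormW p ends a₂ {a₁} {a₁} (fun W => 1 - delClusterProb p ends a₁ {U | b ∈ U} W)
        ({W | o ∈ W}.indicator 1) ((connEvent ends a₂ v).indicator 1)
        (((connEvent ends a₂ v)ᶜ).indicator 1) =
      cell p ends a₁ a₂ b o v true false true * cell p ends a₁ a₂ b o v false true false +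
        cell p ends a₁ a₂ b o v false false true * cell p ends a₁ a₂ b o v true true false -
        cell p ends a₁ a₂ b o v false true true * cell p ends a₁ a₂ b o v true false false -
        cell p ends a₁ a₂ b o v true true true * cell p ends a₁ a₂ b o v false false false := by
  have ha : a₁ ∈ ({a₁} : Finset V) := Finset.mem_singleton_self a₁
  rw [connEvent_eq_clusterInEvent, compl_clusterInEvent]
  unfold mixedFormW
  simp only [Finset.inter_self, Finset.union_self]
  rw [wExpect_one_sub_del_indicator p ends a₂ a₁ ha, wExpect_one_sub_del_indicator p ends a₂ a₁ ha,
    wExpect_one_indicator, wExpect_one_indicator, wExpect_one_sub_del p ends a₂ a₁ ha,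
    wExpect_one_sub_del p ends a₂ a₁ ha, wExpect_indicator_indicator, wExpect_indicator_indicator,
    massPS_ov p ends a₁ a₂ b o v, massPS_ov_b p ends a₁ a₂ b o v, massPS_nv p ends a₁ a₂ b o v,
    massPS_onv p ends a₁ a₂ b o v, massPS_onv_b p ends a₁ a₂ b o v, massPS_v p ends a₁ a₂ b o v,
    massPS_v_b p ends a₁ a₂ b o v, massPS_nv_b p ends a₁ a₂ b o v]
  ring

/-- **(PS) ⟹ (3M)**: the point-split BHK candidate at the source `a₂` implies `ThreeMark` for
every marking `(a₁, b, o, v)`. -/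
theorem threeMark_of_pointSplitBHK [Fintype V] [DecidableEq V] (ends : E → Sym2 V)
    (a₁ a₂ b o v : V) (h : PointSplitBHK (R := R) ends a₂) : ThreeMark (R := R) ends a₁ a₂ b o v := by
  intro p hp
  have hg := delClusterProb_anti p hp ends a₁ (isUpperSet_mem_setOf b)
  have hF : Monotone (fun W => 1 - delClusterProb p ends a₁ {U | b ∈ U} W) := by
    intro W W' hWW'
    simp only
    linarith [hg hWW']
  have hF0 : ∀ S, 0 ≤ (fun W => 1 - delClusterProb p ends a₁ {U | b ∈ U} W) S := by
    intro S
    simp only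
    linarith [delClusterProb_le_one p hp ends a₁ {U | b ∈ U} S]
  have hG : Monotone ({W : Set V | o ∈ W}.indicator (1 : Set V → R)) :=
    monotone_indicator_one_of_isUpperSet (isUpperSet_mem_setOf o)
  have hG0 : ∀ S, 0 ≤ {W : Set V | o ∈ W}.indicator (1 : Set V → R) S :=
    fun S => Set.indicator_apply_nonneg fun _ => zero_le_one
  have key := h p hp {a₁} {a₁} v _ _ hF hG hF0 hG0
  rw [threeMark_slack_eq_mixedForm] at key
  linarith [key]

end PointSplit

end CovForm

end Summit.Ventures.PercRepro2
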